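import Literature.RingTheory.FittingIdeal.EtaleLength
import Mathlib.RingTheory.AdicCompletion.LocalRing
import Mathlib.RingTheory.AdicCompletion.AsTensorProduct
import HarnessLib

/-!
# The length of the singular scheme can be read on the completion (Stacks 02M1 with 07ZA)

Topic: `Literature/RingTheory/FittingIdeal`. For a Noetherian local ring `(R, 𝔪)` the completion
`R → R̂` (Mathlib's `AdicCompletion (maximalIdeal R) R`) is a flat local homomorphism with
`𝔪R̂ = 𝔪_{R̂}` (`AdicCompletion.flat_of_isNoetherian`, `AdicCompletion.maximalIdeal_eq_map`), so
the unramified case of Stacks 02M1 (`Module.length_quotient_map_eq_of_flat_of_map_maximalIdeal`,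
`EtaleLength.lean`) applies. PROVED:

* `Module.length_quotient_map_adicCompletion_eq` — `ℓ_{R̂}(R̂/JR̂) = ℓ_R(R/J)` for every ideal
  `J ⊆ R`;
* `Module.length_quotient_fittingIdeal_adicCompletion_eq` — for a finite `R`-module `M`,
  `ℓ_{R̂}(R̂/Fitt_k(R̂ ⊗_R M)) = ℓ_R(R/Fitt_k(M))` (`Fitt_k(R̂ ⊗ M) = Fitt_k(M) R̂`,
  `Module.fittingIdeal_baseChange`).

For `R = 𝒪_{X,x}` and `M = Ω_{𝒪_{X,x}/𝒪_{S,s}}` this says that de Jong 1996, 3.4's thickness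
`n_T = ℓ(𝒪_{X,η_T}/Fitt₁ Ω)` (2.21; `Scheme.Hom.nodeThickness` in
`Literature/AlgebraicGeometry/Resolution`) is the length of `𝒪̂/Fitt₁(𝒪̂ ⊗ Ω)` on the complete
local ring `𝒪̂_{X,η_T}`, where 2.23/3.3 describe `𝒪̂` by the normal form `A'⟦u, v⟧/(Q - t^{n})`;
what then remains is to identify the completed differential module `𝒪̂ ⊗ Ω` there.

## Sources

* The Stacks Project, Tag 02M1, Tag 07ZA (3); Tag 00MB/00MC (completion of a Noetherian local
  ring is flat, with `𝔪R̂` the maximal ideal). [StacksProject]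
* D. Eisenbud, *Commutative Algebra with a View Toward Algebraic Geometry*, GTM 150 (1995),
  Thm. 7.2 (flatness of completion), Cor. 20.5. [Eisenbud1995]
-/

namespace Literature.RingTheory.FittingIdeal

universe u v

open TensorProduct IsLocalRing

/-- **`ℓ_{R̂}(R̂/JR̂) = ℓ_R(R/J)`** for a Noetherian local ring `R`, its `𝔪`-adic completion
`R̂` and any ideal `J`: the completion is flat and local with `𝔪R̂ = 𝔪_{R̂}`, and Stacks 02M1.
[cite: StacksProject, Tag 02M1] -/
theorem Module.length_quotient_map_adicCompletion_eq {R : Type u} [CommRing R]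
    [IsNoetherianRing R] [IsLocalRing R] (J : Ideal R) :
    Module.length (AdicCompletion (maximalIdeal R) R)
        (AdicCompletion (maximalIdeal R) R ⧸
          J.map (algebraMap R (AdicCompletion (maximalIdeal R) R))) =
      Module.length R (R ⧸ J) :=
  Module.length_quotient_map_eq_of_flat_of_map_maximalIdeal
    (AdicCompletion.maximalIdeal_eq_map (R := R)).symm J

/-- **The length of `R/Fitt_k(M)` is read on the completion**: for a Noetherian local ring `R`
and a finite `R`-module `M`, `ℓ_{R̂}(R̂/Fitt_k(R̂ ⊗_R M)) = ℓ_R(R/Fitt_k(M))` — Fitting ideals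
commute with the base change `R → R̂` (`Module.fittingIdeal_baseChange`, Stacks 07ZA (3)) and
the previous lemma. For `M = Ω_{𝒪_{X,x}/𝒪_{S,s}}` and `k = 1`: de Jong 1996, 3.4's `n_T` is a
length over the complete local ring `𝒪̂_{X,η_T}` of 2.23/3.3. [cite: StacksProject, Tag 07ZA] -/
theorem Module.length_quotient_fittingIdeal_adicCompletion_eq {R : Type u} [CommRing R]
    [IsNoetherianRing R] [IsLocalRing R] (M : Type v) [AddCommGroup M] [Module R M]
    [Module.Finite R M] (k : ℕ) :
    Module.length (AdicCompletion (maximalIdeal R) R)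
        (AdicCompletion (maximalIdeal R) R ⧸
          Module.fittingIdeal (AdicCompletion (maximalIdeal R) R)
            (AdicCompletion (maximalIdeal R) R ⊗[R] M) k) =
      Module.length R (R ⧸ Module.fittingIdeal R M k) := by
  rw [Module.fittingIdeal_baseChange]
  exact Module.length_quotient_map_adicCompletion_eq _

end Literature.RingTheory.FittingIdeal
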